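import Summits.Ventures.Crystal3D.Theorems.StickyWulffConstantTextureBuildHalfDefect
import HarnessLib

/-!
# TB-1: the RISER LINE — a co-axial registry-jump line is paid by the in-plane vacancies of its own balls
# (lane T, crux `TextureLiminfV5`, stmt-Ventures-23912; `stub_TB_cover` repair census TB-1-g19 §1 (FINDING R); ROUTE.md §73.3 (W1) «L-step»)

HONEST FRAMING. Venture `Summits/Ventures/Crystal3D` (cell `crystal3d-full`), route `route-Ventures-StickyWulffConstant`, helper `--supports` the
law-v5 crux `TextureLiminfV5` (stmt-Ventures-23912).  Pure finite combinatorics / Euclidean geometry of packings (census-free, standard axioms).  No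
cover is built, no texture is built, no wall law is touched; rung F-C1 not moved.

WHY THIS FILE (TB-1-g19 §1).  The v8.5 cover interface (`CrustedCover` + `Mesh`, …TextureBuildCrustedCover / …TextureBuildMesh) has no piece that can
certify the RISER facets of a co-axial LAYER-SHARING interface (rigid twin steps, Shockley-type partial lines, lamella tips: the in-layer lines across which
the registry of a layer jumps between two stackings with the same frame): a cylinder cell loses its rim `C(1+h)ρ` against a charge that is only linear in
`ρ`, and designation costs `3·(riser area)`.  ROUTE.md §73.3 (W1) already prescribed a LOCAL COUNT instead («L-step»).  This file is that count, in the
currency of the tiling identity (`halfDefect`, …TextureBuildHalfDefect):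

* `sum_sum_norm_sub_sq_eq` — for points `p ∈ Q` and any centre `c`: `Σ_p Σ_q ‖p − q‖² = 2·#Q·Σ_p ‖p − c‖² − 2·‖Σ_p (p − c)‖²`;
* `card_le_three_of_norm_sub_sq_le_third` — **the 120° lemma**: at most THREE points of a packing (pairwise distance `≥ 1`) lie within `‖· − c‖² ≤ 1/3`
  of a common centre (four would give `Σ_{p≠q}‖p−q‖² ≥ 12 > 2·4·4/3`); this is exactly the situation of the balls of ONE adjacent layer plane touching a
  given ball `b` (they sit on the circle of radius `1/√3` about the foot of `b` in that plane);
* `cdeg_le_card_inter_add_six` — if every ball touching `b` lies in one of the three planes `⟪q − b, n⟫ ∈ {0, ±√(2/3)}` of a unit normal `n` (CO-AXIAL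
  CLEANLINESS (c1)) and the in-plane ones lie in a given finite site set `V` ((c2): in the build, `V` = the in-plane neighbour SITES of `b` in its own
  stacking — balls of the other registry class of the same layer are at in-plane distances `√(1/3), √(4/3), … ∌ 1`), then `cdeg X′ b ≤ #(V ∩ X′) + 6`;
* **`half_card_sdiff_le_halfDefect`** — with `#V ≤ 6`: `halfDefect X′ b ≥ ½·#(V ∖ X′)` — every vacant in-plane site of `b` is half a missing bond that
  nothing can compensate;
* **`riserBudget_le_sum_halfDefect`** — the RISER LINE: summed over a finite set `own` of owned balls with site sets `V b`,
  `riserBudget own V X′ := ½·Σ_{b∈own} #(V b ∖ X′) ≤ Σ_{b∈own} halfDefect X′ b`.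

COUNT ⇒ CHARGE is the texture side (TB-D, not here): per riser layer the texture's facet can be taken as the vertical curtain over the honeycomb path between
occupied and vacant in-plane sites (edge `1/√3` per vacant pair, height `√(2/3)` per slab, each riser layer serving at most two slabs), so its `½`-charge is
`≤ 0.943·riserBudget(one side) ≤ riserBudget(both sides)/1.06`.  The piece kind `RiserPiece` that carries `(own, V, (c1), (c2), #V ≤ 6)` and the cover
`RiseredCover` with `tiling₃` are the sequel file.
WHAT THIS IS NOT: no statement about any configuration's geometry (the hypotheses (c1), (c2), `#V ≤ 6` are discharged by the cover's constructor from
Barlow-layer facts); no cover; F-C1 not moved.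
-/

noncomputable section

namespace Summit.Ventures.Crystal3D.Theorems

open Finset Summit.Ventures.Crystal3D
open scoped InnerProductSpace BigOperators
open Summit.Ventures.Crystal3D.Cruxes.TextureLiminf.TexShadow (E3)

/-! ## The 120° lemma: at most three pairwise-unit-separated points within `1/√3` of a centre -/

/-- For a finite family of points and any centre `c`: `Σ_p Σ_q ‖p − q‖² = 2·#Q·Σ_p ‖p − c‖² − 2·‖Σ_p (p − c)‖²`. -/
theorem sum_sum_norm_sub_sq_eq (Q : Finset E3) (c : E3) :
    ∑ p ∈ Q, ∑ q ∈ Q, ‖p - q‖ ^ 2 =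
      2 * (Q.card : ℝ) * ∑ p ∈ Q, ‖p - c‖ ^ 2 - 2 * ‖∑ p ∈ Q, (p - c)‖ ^ 2 := by
  have hpq : ∀ p q : E3, ‖p - q‖ ^ 2 = ‖p - c‖ ^ 2 - 2 * ⟪p - c, q - c⟫_ℝ + ‖q - c‖ ^ 2 := by
    intro p q
    have : p - q = (p - c) - (q - c) := by abel
    rw [this, norm_sub_sq_real]
  have step1 : ∑ p ∈ Q, ∑ q ∈ Q, ‖p - q‖ ^ 2 =
      ∑ p ∈ Q, ∑ q ∈ Q, (‖p - c‖ ^ 2 - 2 * ⟪p - c, q - c⟫_ℝ + ‖q - c‖ ^ 2) :=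
    Finset.sum_congr rfl fun p _ => Finset.sum_congr rfl fun q _ => hpq p q
  have hinner : ‖∑ p ∈ Q, (p - c)‖ ^ 2 = ∑ p ∈ Q, ∑ q ∈ Q, ⟪p - c, q - c⟫_ℝ := by
    rw [← real_inner_self_eq_norm_sq, sum_inner]
    exact Finset.sum_congr rfl fun p _ => inner_sum _ _ _
  rw [step1, hinner]
  simp only [Finset.sum_add_distrib, Finset.sum_sub_distrib]
  have h1 : ∑ p ∈ Q, ∑ _q ∈ Q, ‖p - c‖ ^ 2 = (Q.card : ℝ) * ∑ p ∈ Q, ‖p - c‖ ^ 2 := by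
    rw [Finset.mul_sum]
    refine Finset.sum_congr rfl fun p _ => ?_
    rw [Finset.sum_const, nsmul_eq_mul]
  have h2 : ∑ _p ∈ Q, ∑ q ∈ Q, ‖q - c‖ ^ 2 = (Q.card : ℝ) * ∑ q ∈ Q, ‖q - c‖ ^ 2 := by
    rw [Finset.sum_const, nsmul_eq_mul]
  have h3 : ∑ p ∈ Q, ∑ q ∈ Q, 2 * ⟪p - c, q - c⟫_ℝ = 2 * ∑ p ∈ Q, ∑ q ∈ Q, ⟪p - c, q - c⟫_ℝ := by
    rw [Finset.mul_sum]
    refine Finset.sum_congr rfl fun p _ => ?_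
    rw [Finset.mul_sum]
  rw [h1, h2, h3]
  ring

/-- **The 120° lemma.**  In a packing (pairwise distances `≥ 1`) at most three points lie within squared distance `1/3` of a common centre.
(Four such points would have `Σ_{p ≠ q} ‖p − q‖² ≥ 12`, but the identity above bounds that double sum by `2·4·(4/3) < 12`.) -/
theorem card_le_three_of_norm_sub_sq_le_third (Q : Finset E3) (c : E3)
    (hsep : ∀ p ∈ Q, ∀ q ∈ Q, p ≠ q → 1 ≤ dist p q) (hQ : ∀ q ∈ Q, ‖q - c‖ ^ 2 ≤ 1 / 3) :
    Q.card ≤ 3 := by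
  -- lower bound: each off-diagonal term is ≥ 1
  have hlow : (Q.card : ℝ) * ((Q.card : ℝ) - 1) ≤ ∑ p ∈ Q, ∑ q ∈ Q, ‖p - q‖ ^ 2 := by
    have hrow : ∀ p ∈ Q, ((Q.card : ℝ) - 1) ≤ ∑ q ∈ Q, ‖p - q‖ ^ 2 := by
      intro p hp
      have hsplit : ∑ q ∈ Q, ‖p - q‖ ^ 2 = ∑ q ∈ Q.erase p, ‖p - q‖ ^ 2 + ‖p - p‖ ^ 2 := by
        rw [← Finset.sum_erase_add _ _ hp]
      rw [hsplit, sub_self, norm_zero]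
      have hge : ∑ q ∈ Q.erase p, (1 : ℝ) ≤ ∑ q ∈ Q.erase p, ‖p - q‖ ^ 2 := by
        refine Finset.sum_le_sum fun q hq => ?_
        have hq' := Finset.mem_erase.1 hq
        have h1 : 1 ≤ dist p q := hsep p hp q hq'.2 (Ne.symm hq'.1)
        rw [dist_eq_norm] at h1
        nlinarith [norm_nonneg (p - q)]
      rw [Finset.sum_const, nsmul_eq_mul, mul_one, Finset.card_erase_of_mem hp, Nat.cast_sub (Finset.card_pos.2 ⟨p, hp⟩)] at hge
      simpa using hge
    calc (Q.card : ℝ) * ((Q.card : ℝ) - 1) = ∑ _p ∈ Q, ((Q.card : ℝ) - 1) := by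
          rw [Finset.sum_const, nsmul_eq_mul]
      _ ≤ ∑ p ∈ Q, ∑ q ∈ Q, ‖p - q‖ ^ 2 := Finset.sum_le_sum hrow
  -- upper bound from the identity
  have hup : ∑ p ∈ Q, ∑ q ∈ Q, ‖p - q‖ ^ 2 ≤ 2 * (Q.card : ℝ) * ((Q.card : ℝ) * (1 / 3)) := by
    rw [sum_sum_norm_sub_sq_eq Q c]
    have hs : ∑ p ∈ Q, ‖p - c‖ ^ 2 ≤ (Q.card : ℝ) * (1 / 3) := by
      calc ∑ p ∈ Q, ‖p - c‖ ^ 2 ≤ ∑ _p ∈ Q, (1 / 3 : ℝ) := Finset.sum_le_sum hQ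
        _ = (Q.card : ℝ) * (1 / 3) := by rw [Finset.sum_const, nsmul_eq_mul]
    have hn : (0 : ℝ) ≤ 2 * (Q.card : ℝ) := by positivity
    nlinarith [sq_nonneg ‖∑ p ∈ Q, (p - c)‖, mul_le_mul_of_nonneg_left hs hn]
  -- combine: n(n−1) ≤ 2n²/3 ⇒ n ≤ 3
  have hn : (Q.card : ℝ) * ((Q.card : ℝ) - 1) ≤ 2 * (Q.card : ℝ) * ((Q.card : ℝ) * (1 / 3)) := hlow.trans hup
  by_contra h
  have h4 : (4 : ℝ) ≤ (Q.card : ℝ) := by exact_mod_cast Nat.lt_of_not_le h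
  nlinarith

/-! ## Degree split along three layer planes -/

/-- the layer spacing `√(2/3)` of a unit Barlow stacking -/
private theorem sq_sqrt_two_thirds : Real.sqrt (2 / 3) ^ 2 = 2 / 3 :=
  Real.sq_sqrt (by norm_num)

/-- Balls of an adjacent layer plane (`⟪q − b, n⟫ = ±√(2/3)`, `‖n‖ = 1`) that touch `b` are within squared distance `1/3` of the foot `b ± √(2/3)•n`. -/
theorem norm_sub_foot_sq_of_touch (b q n : E3) (hn : ‖n‖ = 1) (t : ℝ) (ht : t ^ 2 = 2 / 3) (hd : dist b q = 1)
    (hplane : ⟪q - b, n⟫_ℝ = t) : ‖q - (b + t • n)‖ ^ 2 ≤ 1 / 3 := by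
  have h1 : ‖q - b‖ = 1 := by rw [← dist_eq_norm, dist_comm]; exact hd
  have hexp : q - (b + t • n) = (q - b) - t • n := by abel
  rw [hexp, norm_sub_sq_real, h1, norm_smul, hn, mul_one, Real.norm_eq_abs, sq_abs, inner_smul_right, hplane, ht]
  nlinarith [ht]

/-- **Degree split** (co-axial cleanliness).  If every ball touching `b` lies in one of the three planes `⟪q − b, n⟫ ∈ {0, √(2/3), −√(2/3)}` and the in-plane
ones lie in the finite site set `V`, then `cdeg X′ b ≤ #(V ∩ X′) + 6`. -/
theorem cdeg_le_card_inter_add_six (X' : Finset E3) (hX : ∀ p ∈ X', ∀ q ∈ X', p ≠ q → 1 ≤ dist p q) (b n : E3) (hn : ‖n‖ = 1)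
    (V : Finset E3)
    (hplanes : ∀ q ∈ X', dist b q = 1 →
      ⟪q - b, n⟫_ℝ = 0 ∨ ⟪q - b, n⟫_ℝ = Real.sqrt (2 / 3) ∨ ⟪q - b, n⟫_ℝ = -Real.sqrt (2 / 3))
    (hin : ∀ q ∈ X', dist b q = 1 → ⟪q - b, n⟫_ℝ = 0 → q ∈ V) :
    cdeg X' b ≤ (V ∩ X').card + 6 := by
  classical
  unfold cdeg
  set C := X'.filter fun q => dist b q = 1 with hC
  set C₀ := C.filter fun q => ⟪q - b, n⟫_ℝ = 0 with hC₀
  set Cp := C.filter fun q => ⟪q - b, n⟫_ℝ = Real.sqrt (2 / 3) with hCp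
  set Cm := C.filter fun q => ⟪q - b, n⟫_ℝ = -Real.sqrt (2 / 3) with hCm
  have hcover : C ⊆ C₀ ∪ Cp ∪ Cm := by
    intro q hq
    have hq' := Finset.mem_filter.1 hq
    rcases hplanes q hq'.1 hq'.2 with h | h | h
    · exact Finset.mem_union.2 (Or.inl (Finset.mem_union.2 (Or.inl (Finset.mem_filter.2 ⟨hq, h⟩))))
    · exact Finset.mem_union.2 (Or.inl (Finset.mem_union.2 (Or.inr (Finset.mem_filter.2 ⟨hq, h⟩))))
    · exact Finset.mem_union.2 (Or.inr (Finset.mem_filter.2 ⟨hq, h⟩))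
  have hsepC : ∀ D : Finset E3, D ⊆ C → ∀ p ∈ D, ∀ q ∈ D, p ≠ q → 1 ≤ dist p q := by
    intro D hD p hp q hq hpq
    exact hX p (Finset.mem_filter.1 (hD hp)).1 q (Finset.mem_filter.1 (hD hq)).1 hpq
  -- in-plane contacts are occupied sites of V
  have h0 : C₀.card ≤ (V ∩ X').card := by
    refine Finset.card_le_card fun q hq => ?_
    have hq' := Finset.mem_filter.1 hq
    have hqC := Finset.mem_filter.1 hq'.1
    exact Finset.mem_inter.2 ⟨hin q hqC.1 hqC.2 hq'.2, hqC.1⟩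
  -- at most three contacts from each adjacent plane
  have hp3 : Cp.card ≤ 3 := by
    refine card_le_three_of_norm_sub_sq_le_third Cp (b + Real.sqrt (2 / 3) • n)
      (hsepC Cp (Finset.filter_subset _ _)) fun q hq => ?_
    have hq' := Finset.mem_filter.1 hq
    have hqC := Finset.mem_filter.1 hq'.1
    exact norm_sub_foot_sq_of_touch b q n hn _ sq_sqrt_two_thirds hqC.2 hq'.2
  have hm3 : Cm.card ≤ 3 := by
    refine card_le_three_of_norm_sub_sq_le_third Cm (b + (-Real.sqrt (2 / 3)) • n)
      (hsepC Cm (Finset.filter_subset _ _)) fun q hq => ?_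
    have hq' := Finset.mem_filter.1 hq
    have hqC := Finset.mem_filter.1 hq'.1
    exact norm_sub_foot_sq_of_touch b q n hn _ (by rw [neg_sq]; exact sq_sqrt_two_thirds) hqC.2 hq'.2
  calc C.card ≤ (C₀ ∪ Cp ∪ Cm).card := Finset.card_le_card hcover
    _ ≤ (C₀ ∪ Cp).card + Cm.card := Finset.card_union_le _ _
    _ ≤ C₀.card + Cp.card + Cm.card := by gcongr; exact Finset.card_union_le _ _
    _ ≤ (V ∩ X').card + 6 := by omega

/-! ## The per-ball riser inequality and the riser line -/

/-- **Per-ball riser inequality**: under co-axial cleanliness and `#V ≤ 6`, `halfDefect X′ b ≥ ½·#(V ∖ X′)` — every vacant in-plane neighbour site of `b`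
is an uncompensated half-bond. -/
theorem half_card_sdiff_le_halfDefect (X' : Finset E3) (hX : ∀ p ∈ X', ∀ q ∈ X', p ≠ q → 1 ≤ dist p q) (b n : E3) (hn : ‖n‖ = 1)
    (V : Finset E3) (hV : V.card ≤ 6)
    (hplanes : ∀ q ∈ X', dist b q = 1 →
      ⟪q - b, n⟫_ℝ = 0 ∨ ⟪q - b, n⟫_ℝ = Real.sqrt (2 / 3) ∨ ⟪q - b, n⟫_ℝ = -Real.sqrt (2 / 3))
    (hin : ∀ q ∈ X', dist b q = 1 → ⟪q - b, n⟫_ℝ = 0 → q ∈ V) :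
    ((V \ X').card : ℝ) / 2 ≤ halfDefect X' b := by
  classical
  have hc := cdeg_le_card_inter_add_six X' hX b n hn V hplanes hin
  have hsplit : (V \ X').card + (V ∩ X').card = V.card := Finset.card_sdiff_add_card_inter V X'
  unfold halfDefect
  have hc' : (cdeg X' b : ℝ) ≤ ((V ∩ X').card : ℝ) + 6 := by exact_mod_cast hc
  have hsplit' : ((V \ X').card : ℝ) + ((V ∩ X').card : ℝ) = (V.card : ℝ) := by exact_mod_cast hsplit
  have hV' : (V.card : ℝ) ≤ 6 := by exact_mod_cast hV
  linarith

/-- the RISER BUDGET of a set of owned balls with in-plane site sets `V b`: half the number of their vacant in-plane sites. -/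
def riserBudget (own : Finset E3) (V : E3 → Finset E3) (X' : Finset E3) : ℝ :=
  (∑ b ∈ own, ((V b \ X').card : ℝ)) / 2

/-- The riser budget is nonnegative. -/
theorem riserBudget_nonneg (own : Finset E3) (V : E3 → Finset E3) (X' : Finset E3) : 0 ≤ riserBudget own V X' := by
  unfold riserBudget
  exact div_nonneg (Finset.sum_nonneg fun _ _ => Nat.cast_nonneg _) (by norm_num)

/-- **THE RISER LINE**: a riser piece's budget is paid by the half-defects of its own balls,
`riserBudget own V X′ ≤ Σ_{b ∈ own} halfDefect X′ b`, under per-ball co-axial cleanliness (c1), in-plane site control (c2) and `#V b ≤ 6`. -/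
theorem riserBudget_le_sum_halfDefect (X' : Finset E3) (hX : ∀ p ∈ X', ∀ q ∈ X', p ≠ q → 1 ≤ dist p q)
    (own : Finset E3) (n : E3) (hn : ‖n‖ = 1) (V : E3 → Finset E3) (hV : ∀ b ∈ own, (V b).card ≤ 6)
    (hplanes : ∀ b ∈ own, ∀ q ∈ X', dist b q = 1 →
      ⟪q - b, n⟫_ℝ = 0 ∨ ⟪q - b, n⟫_ℝ = Real.sqrt (2 / 3) ∨ ⟪q - b, n⟫_ℝ = -Real.sqrt (2 / 3))
    (hin : ∀ b ∈ own, ∀ q ∈ X', dist b q = 1 → ⟪q - b, n⟫_ℝ = 0 → q ∈ V b) :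
    riserBudget own V X' ≤ ∑ b ∈ own, halfDefect X' b := by
  unfold riserBudget
  rw [Finset.sum_div]
  exact Finset.sum_le_sum fun b hb =>
    half_card_sdiff_le_halfDefect X' hX b n hn (V b) (hV b hb) (hplanes b hb) (hin b hb)

end Summit.Ventures.Crystal3D.Theorems

end
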